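import Summits.CriticalPhenomena.Ising3DConformalLimit.Theorems.PerfectScreeningCoulombImpliesNontrivialGapOfBinder
import Summits.CriticalPhenomena.Ising3DConformalLimit.Theorems.LeeYangGapNearCriticalLeeYangGapSusceptibilityDoubling
import Literature.Probability.LatticeModels.CriticalTwoPointAxisLimsup

/-!
# A mean-field critical isotherm would force the near-critical Lee–Yang gap (crux 4945), unconditionally

Route `LeeYangGap` (Ising3DConformalLimit), crux `NearCriticalLeeYangGap` (GAP, item
stmt-CriticalPhenomena-4945: block non-Gaussianity of critical `ℤ³` Ising along a subsequence, in Lee–Yang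
dress). This file is an UNCONDITIONAL entrance to GAP through the critical isotherm, and — read
contrapositively — a kernel-checked dichotomy for the nearest-neighbour Ising model on `ℤ³` at `β_c`:

  either the critical block Binder cumulant `g_L := (3Σ_L² − ⟨M_L⁴⟩)/Σ_L²` does not tend to `0`
  (GAP, via the landed `stub_gapOfBinderNonvanishing`), or the critical isotherm is strictly anomalous in
  amplitude, `limsup_{h→0⁺} m(β_c,h)·h^{-1/3} = ∞`

(`superIsotherm_cuberoot_of_vanishingBinder`, `binder_not_tendsto_zero_of_isotherm_cuberoot`,
`nearCriticalLeeYangGap_of_isotherm_cuberoot`). In words: the `d = 3` critical point cannot be mean-field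
BOTH in its block-spin law (asymptotically Gaussian) and in its critical isotherm (`m ≤ A h^{1/3}`, the
Aizenman–Barsky–Fernández exponent with a bounded amplitude) — whereas for `d ≥ 5` both hold.

Mechanism (Newman 1979's Buckingham–Gunton argument, made finite-size and one-sided; the tree's line
`SketchPub` of crux `PerfectScreening.CoulombImpliesNontrivial`, stmt-13885, with its Coulomb variance law
replaced by an unconditional floor):
* T1a (`sketchPub_blockTiltedMean_ge`, Lee–Yang/Newman 1975): below the first Lee–Yang zero the critical
  block responds linearly to a block field, `tΣ_L/2 ≤ ⟨M_L e^{tM_L}⟩/⟨e^{tM_L}⟩` for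
  `π²√((3Σ_L²−⟨M_L⁴⟩)/12)·sinh²t ≤ 2`;
* S3 (`stub_blockFieldDomination`, GKS): `⟨M_L e^{β_c h M_L}⟩ ≤ (2L+1)³ m(β_c,h) ⟨e^{β_c h M_L}⟩`;
* NEW INPUT, unconditional (`criticalBlockVariance_frequently_ge`, from Duminil-Copin–Panis 2025 Thm 1.3 in
  subsequence form `criticalTwoPoint_axis_frequently_ge` + Messager–Miracle-Solé; also in Literature as
  `criticalTwoPoint_boxPairSum_frequently_ge`):
  `a·L^{9/2} ≤ Σ_L` for infinitely many `L` ("`η ≤ 1/2` along a subsequence", block form);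
* bookkeeping (`superIsotherm_cuberoot_of_hypotheses`): at a good `L` with `g_L` small, the admissible
  block field `t ≍ (g_LΣ_L²)^{-1/4}` gives `m(β_c, t/β_c) ≥ tΣ_L/(54L³)`, and `Σ_L ≥ aL^{9/2}` is exactly
  what makes this exceed `A(t/β_c)^{1/3}` once `g_L < g_*(A,a)`: the exponent `1/3` is the
  Buckingham–Gunton partner `δ = (d+2−η)/(d−2+η) = 3` of `η = 1/2` in `d = 3`.
So the printed rung `η ≤ 1/2` (DCP 2025) saturates Buckingham–Gunton against `δ = 3`, and a vanishing
Binder cumulant then forces the isotherm amplitude at exponent `1/3` to diverge. Under the Coulomb law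
(`η = 0`, `Σ_L ≍ L⁵`) the same mechanism gives exponent `1/5` (SketchPub T1b); here nothing is assumed.
Relation to the crux's live line `one_arm_saturation` (Cruxes/NearCriticalLeeYangGap/Lines): there the
matched upper critical isotherm `(2L+1)³ m(β_c, C/√Σ_L) ≤ ½β_c C√Σ_L` FREQUENTLY in `L` is shown to give GAP and
is reduced to one-arm hyperscaling (item stmt-CriticalPhenomena-15591); the hypothesis of this file
(`m ≤ A h^{1/3}` near `0`) together with `criticalBlockVariance_frequently_ge` implies that matched isotherm at
the good scales (take `C` large), so this file is the `δ = 3` corner of the same funnel, proved directly and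
without any open input.

References: C. M. Newman, Comm. Math. Phys. 41 (1975) 1–9 (Lee–Yang class, first-zero bound);
C. M. Newman, *Critical point inequalities and scaling limits*, Comm. Math. Phys. 66 (1979) 181–196
(Buckingham–Gunton `2 − η ≤ d(δ−1)/(δ+1)` and block-spin limits; R. S. Ellis, *Entropy, Large Deviations,
and Statistical Mechanics*, Thms V.8.4, V.8.6); M. Aizenman, D. Barsky, R. Fernández, J. Stat. Phys. 47
(1987) (`m(β_c,h) ≥ c h^{1/3}`); H. Duminil-Copin, R. Panis, Comm. Math. Phys. 406 (2025), Thm 1.3.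
-/

noncomputable section

namespace Summit.CriticalPhenomena.Ising3DConformalLimit.LeeYangGapNearCriticalLeeYangGap

open Literature.Probability.LatticeModels Filter Set Finset
open Summit.CriticalPhenomena.Ising3DConformalLimit.PerfectScreeningCoulombImpliesNontrivial
open Summit.CriticalPhenomena.Ising3DConformalLimit.LeeYangGapGaussianLimitKillsBlockCoupling
open scoped Topology BigOperators

/-! ## Part A. Abstract bookkeeping: super-isotherm at exponent `1/3` along good scales -/

/-- The arithmetic of the response chain at one scale: from `0 < t`, `1 ≤ Lr`, `0 < V`,
`tV/2 ≤ R ≤ (2Lr+1)³·mag` conclude `t·V ≤ 54·Lr³·mag` and `0 < mag`. -/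
theorem tilted_chain_le {t Lr V R mag : ℝ} (ht : 0 < t) (hL1 : 1 ≤ Lr) (hV : 0 < V)
    (hT : t * V / 2 ≤ R) (hR : R ≤ (2 * Lr + 1) ^ 3 * mag) :
    t * V ≤ 54 * Lr ^ 3 * mag ∧ 0 < mag := by
  have hpos : 0 < t * V / 2 := by positivity
  have h1 : t * V / 2 ≤ (2 * Lr + 1) ^ 3 * mag := hT.trans hR
  have hmag : 0 < mag := by
    have h2 : 0 < (2 * Lr + 1) ^ 3 * mag := hpos.trans_le h1
    exact pos_of_mul_pos_right h2 (by positivity)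
  have hcube : (2 * Lr + 1) ^ 3 ≤ 27 * Lr ^ 3 := by
    have h3 : 2 * Lr + 1 ≤ 3 * Lr := by linarith
    calc (2 * Lr + 1) ^ 3 ≤ (3 * Lr) ^ 3 := pow_le_pow_left₀ (by linarith) h3 3
      _ = 27 * Lr ^ 3 := by ring
  refine ⟨?_, hmag⟩
  have h2 : t * V / 2 ≤ 27 * Lr ^ 3 * mag := h1.trans (mul_le_mul_of_nonneg_right hcube hmag.le)
  linarith

/-- **Super-isotherm at exponent `1/3` for abstract data.** Let `β > 0`, `V K : ℕ → ℝ`, `mag : ℝ → ℝ`,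
`Eexp Etilt : ℕ → ℝ → ℝ` satisfy `Eexp > 0`, the T1a-shape linear response below the first Lee–Yang zero
(`0 ≤ t ≤ 1`, `π²√(K L/12) sinh² t ≤ 2 ⟹ t V L/2 ≤ Etilt L t/Eexp L t`), GKS block-field domination
(`Etilt L (βh) ≤ (2L+1)³ mag h · Eexp L (βh)`, `h ≥ 0`), the FLOOR `a·L^{9/2} ≤ V L` for infinitely many
`L`, and `K L/(V L)² → 0`. Then for every `A` and `h₀ > 0` there is `h ∈ (0, h₀]` with `A·h^{1/3} < mag h`.
Proof: at a good large `L`, with `t_c = min(1, βh₀)` and `S = π²√(K L/12)`, take the block field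
`t = t_c` if `S sinh² t_c ≤ 2`, else `t = (2S)^{-1/2} < t_c` (then `S sinh² t ≤ 4St² = 2`); the chain gives
`mag(t/β) ≥ tV L/(54L³)`; in the first case `V L ≥ aL^{9/2} ≥ aL⁴` makes this `≥ (t_c a/54)L`, in the
second `βt²V³ = βV³/(2S) > 54³A³L⁹` as soon as `K L ≤ 6c₀²(V L)²`, `c₀ = βa²/(2π²54³A³)`, i.e.
`(A(t/β)^{1/3})³ < (tV/(54L³))³ ≤ mag³`. -/
theorem superIsotherm_cuberoot_of_hypotheses {β : ℝ} (hβ : 0 < β) (V K : ℕ → ℝ) (mag : ℝ → ℝ)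
    (Eexp Etilt : ℕ → ℝ → ℝ) (hEpos : ∀ (L : ℕ) (t : ℝ), 0 < Eexp L t)
    (hT1a : ∀ (L : ℕ) (t : ℝ), 0 ≤ t → t ≤ 1 →
      Real.pi ^ 2 * Real.sqrt (K L / 12) * Real.sinh t ^ 2 ≤ 2 → t * V L / 2 ≤ Etilt L t / Eexp L t)
    (hGKS : ∀ (L : ℕ) (h : ℝ), 0 ≤ h → Etilt L (β * h) ≤ (2 * L + 1) ^ 3 * mag h * Eexp L (β * h))
    (hVar : ∃ a : ℝ, 0 < a ∧ ∃ᶠ L : ℕ in atTop, a * (L : ℝ) ^ (9 / 2 : ℝ) ≤ V L)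
    (hBinder : Tendsto (fun L : ℕ => K L / (V L) ^ 2) atTop (𝓝 0))
    (A h₀ : ℝ) (hh₀ : 0 < h₀) :
    ∃ h : ℝ, 0 < h ∧ h ≤ h₀ ∧ A * h ^ ((1:ℝ) / 3) < mag h := by
  -- WLOG `A ≥ 1 > 0`
  suffices hmain : ∃ h : ℝ, 0 < h ∧ h ≤ h₀ ∧ max A 1 * h ^ ((1:ℝ) / 3) < mag h by
    obtain ⟨h, hh, hhle, hlt⟩ := hmain
    exact ⟨h, hh, hhle, (mul_le_mul_of_nonneg_right (le_max_left A 1)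
      (Real.rpow_nonneg hh.le _)).trans_lt hlt⟩
  set A' : ℝ := max A 1 with hA'
  have hA'1 : 1 ≤ A' := le_max_right A 1
  have hA'0 : 0 < A' := one_pos.trans_le hA'1
  obtain ⟨a, ha, hfreq⟩ := hVar
  have hπ : 0 < Real.pi := Real.pi_pos
  -- the constant field `t_c = min 1 (β h₀)` and its cube-root partner `q = (t_c/β)^{1/3}`
  set t_c : ℝ := min 1 (β * h₀) with ht_c
  have ht_c0 : 0 < t_c := lt_min one_pos (mul_pos hβ hh₀)
  have ht_c1 : t_c ≤ 1 := min_le_left _ _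
  have ht_cβ : t_c ≤ β * h₀ := min_le_right _ _
  set q : ℝ := (t_c / β) ^ ((1:ℝ) / 3) with hq
  have hq0 : 0 ≤ q := Real.rpow_nonneg (div_pos ht_c0 hβ).le _
  -- threshold for case A: `L > 54 A' q/(t_c a)`
  set N₁ : ℝ := 54 * A' * q / (t_c * a) + 1 with hN₁
  -- threshold for case B: `K L ≤ 6 c₀² (V L)²`
  set D : ℝ := 54 ^ 3 * A' ^ 3 with hD
  have hD0 : 0 < D := by positivity
  set c₀ : ℝ := β * a ^ 2 / (2 * Real.pi ^ 2 * D) with hc₀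
  have hc₀0 : 0 < c₀ := by positivity
  obtain ⟨L₁, hL₁1, hL₁⟩ := exists_forall_ge_le_of_tendsto_zero hBinder (ε := 6 * c₀ ^ 2) (by positivity)
  -- a good scale beyond both thresholds
  obtain ⟨L, hLge, hVL⟩ := Filter.frequently_atTop.1 hfreq (max ⌈N₁⌉₊ L₁)
  have hLL₁ : L₁ ≤ L := (le_max_right _ _).trans hLge
  have hLN₁ : N₁ ≤ (L : ℝ) := (Nat.le_ceil N₁).trans (by exact_mod_cast (le_max_left _ _).trans hLge)
  have hL1 : 1 ≤ L := hL₁1.trans hLL₁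
  have hLr1 : (1 : ℝ) ≤ L := by exact_mod_cast hL1
  have hLr0 : (0 : ℝ) < L := by positivity
  have hL92 : 0 < (L : ℝ) ^ (9 / 2 : ℝ) := Real.rpow_pos_of_pos hLr0 _
  have hV0 : 0 < V L := lt_of_lt_of_le (mul_pos ha hL92) hVL
  obtain ⟨S, hS⟩ : ∃ S : ℝ, S = Real.pi ^ 2 * Real.sqrt (K L / 12) := ⟨_, rfl⟩
  have hS0 : 0 ≤ S := by rw [hS]; positivity
  by_cases hcase : S * Real.sinh t_c ^ 2 ≤ 2
  · -- Case A: the constant field `h = t_c/β` is admissible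
    refine ⟨t_c / β, div_pos ht_c0 hβ, (div_le_iff₀ hβ).2 (by linarith), ?_⟩
    have hβh : β * (t_c / β) = t_c := by field_simp
    have hT := hT1a L t_c ht_c0.le ht_c1 (by rw [← hS]; exact hcase)
    have hG := hGKS L (t_c / β) (div_pos ht_c0 hβ).le
    rw [hβh] at hG
    have hR : Etilt L t_c / Eexp L t_c ≤ (2 * (L : ℝ) + 1) ^ 3 * mag (t_c / β) :=
      (div_le_iff₀ (hEpos L t_c)).2 hG
    obtain ⟨hchain, hmag⟩ := tilted_chain_le ht_c0 hLr1 hV0 hT hR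
    -- `V L ≥ a L^{9/2} ≥ a L^4 = a L³ · L`
    have hL4 : (L : ℝ) ^ 4 ≤ (L : ℝ) ^ (9 / 2 : ℝ) := by
      have h := Real.rpow_le_rpow_of_exponent_le hLr1 (show (4 : ℝ) ≤ 9 / 2 by norm_num)
      norm_num at h
      exact h
    have h1 : t_c * (a * (L : ℝ) ^ 4) ≤ 54 * (L : ℝ) ^ 3 * mag (t_c / β) := by
      calc t_c * (a * (L : ℝ) ^ 4) ≤ t_c * (a * (L : ℝ) ^ (9 / 2 : ℝ)) :=
            mul_le_mul_of_nonneg_left (mul_le_mul_of_nonneg_left hL4 ha.le) ht_c0.le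
        _ ≤ t_c * V L := mul_le_mul_of_nonneg_left hVL ht_c0.le
        _ ≤ 54 * (L : ℝ) ^ 3 * mag (t_c / β) := hchain
    have h2 : t_c * a * (L : ℝ) ≤ 54 * mag (t_c / β) := by
      have hL3 : 0 < (L : ℝ) ^ 3 := pow_pos hLr0 3
      have key : (L : ℝ) ^ 3 * (t_c * a * L) ≤ (L : ℝ) ^ 3 * (54 * mag (t_c / β)) := by nlinarith
      exact le_of_mul_le_mul_left key hL3
    -- `L ≥ N₁ > 54 A' q/(t_c a)` closes
    have h3 : 54 * A' * q < t_c * a * (L : ℝ) := by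
      have hta : 0 < t_c * a := mul_pos ht_c0 ha
      have h4 : 54 * A' * q / (t_c * a) < (L : ℝ) := by linarith
      have := (div_lt_iff₀ hta).1 h4
      linarith
    change A' * q < mag (t_c / β)
    linarith
  · -- Case B: `S sinh² t_c > 2`; take `t = (2S)^{-1/2}`
    have hcase' : 2 < S * Real.sinh t_c ^ 2 := lt_of_not_ge hcase
    have hSpos : 0 < S := by
      rcases hS0.lt_or_eq with h | h
      · exact h
      · rw [← h, zero_mul] at hcase'; linarith
    set t : ℝ := Real.sqrt (1 / (2 * S)) with ht
    have ht0 : 0 < t := Real.sqrt_pos.2 (by positivity)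
    have ht2 : t ^ 2 = 1 / (2 * S) := Real.sq_sqrt (by positivity)
    have h4St2 : 4 * S * t ^ 2 = 2 := by rw [ht2]; field_simp; ring
    -- `t < t_c ≤ 1`
    have hsinh_c : Real.sinh t_c ≤ 2 * t_c := sinh_le_two_mul_of_le_one ht_c0.le ht_c1
    have hsinh_c0 : 0 ≤ Real.sinh t_c := Real.sinh_nonneg_iff.2 ht_c0.le
    have httc : t < t_c := by
      have h1 : S * (4 * t ^ 2) < S * Real.sinh t_c ^ 2 := by
        rw [show S * (4 * t ^ 2) = 4 * S * t ^ 2 by ring, h4St2]; exact hcase'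
      have h2 : 4 * t ^ 2 < Real.sinh t_c ^ 2 := lt_of_mul_lt_mul_left h1 hSpos.le
      have h3 : Real.sinh t_c ^ 2 ≤ (2 * t_c) ^ 2 := pow_le_pow_left₀ hsinh_c0 hsinh_c 2
      have h3' : (2 * t_c) ^ 2 = 4 * t_c ^ 2 := by ring
      have h4 : t ^ 2 < t_c ^ 2 := by linarith
      exact lt_of_pow_lt_pow_left₀ 2 ht_c0.le h4
    have ht1 : t ≤ 1 := (httc.le).trans ht_c1
    -- admissibility of `t`
    have hsinh_t : Real.sinh t ≤ 2 * t := sinh_le_two_mul_of_le_one ht0.le ht1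
    have hsinh_t0 : 0 ≤ Real.sinh t := Real.sinh_nonneg_iff.2 ht0.le
    have hcond : Real.pi ^ 2 * Real.sqrt (K L / 12) * Real.sinh t ^ 2 ≤ 2 := by
      rw [← hS]
      have h1 : Real.sinh t ^ 2 ≤ (2 * t) ^ 2 := pow_le_pow_left₀ hsinh_t0 hsinh_t 2
      calc S * Real.sinh t ^ 2 ≤ S * (2 * t) ^ 2 := mul_le_mul_of_nonneg_left h1 hS0
        _ = 4 * S * t ^ 2 := by ring
        _ ≤ 2 := h4St2.le
    refine ⟨t / β, div_pos ht0 hβ, ?_, ?_⟩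
    · rw [div_le_iff₀ hβ]; linarith
    have hβh : β * (t / β) = t := by field_simp
    have hT := hT1a L t ht0.le ht1 hcond
    have hG := hGKS L (t / β) (div_pos ht0 hβ).le
    rw [hβh] at hG
    have hR : Etilt L t / Eexp L t ≤ (2 * (L : ℝ) + 1) ^ 3 * mag (t / β) :=
      (div_le_iff₀ (hEpos L t)).2 hG
    obtain ⟨hchain, hmag⟩ := tilted_chain_le ht0 hLr1 hV0 hT hR
    -- `a² L⁹ ≤ V²`
    have hL9 : a ^ 2 * (L : ℝ) ^ 9 ≤ V L ^ 2 := by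
      have h1 : (a * (L : ℝ) ^ (9 / 2 : ℝ)) ^ 2 ≤ V L ^ 2 :=
        pow_le_pow_left₀ (by positivity) hVL 2
      have h2 : ((L : ℝ) ^ (9 / 2 : ℝ)) ^ 2 = (L : ℝ) ^ 9 := by
        rw [← Real.rpow_natCast ((L : ℝ) ^ (9 / 2 : ℝ)) 2, ← Real.rpow_mul hLr0.le]
        norm_num
      calc a ^ 2 * (L : ℝ) ^ 9 = (a * (L : ℝ) ^ (9 / 2 : ℝ)) ^ 2 := by rw [mul_pow, h2]
        _ ≤ V L ^ 2 := h1
    -- Binder smallness at `L`: `√(K/12) < c₀ V`, hence `S < π² c₀ V`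
    have hK : K L ≤ 6 * c₀ ^ 2 * V L ^ 2 :=
      (div_le_iff₀ (by positivity)).1 (hL₁ L hLL₁)
    have hsqrt : Real.sqrt (K L / 12) < c₀ * V L := by
      have hcV : 0 < c₀ ^ 2 * V L ^ 2 := by positivity
      have h1 : K L / 12 < (c₀ * V L) ^ 2 := by rw [mul_pow]; linarith
      exact (Real.sqrt_lt' (by positivity)).2 h1
    have hSlt : S < Real.pi ^ 2 * (c₀ * V L) := by
      rw [hS]
      exact mul_lt_mul_of_pos_left hsqrt (by positivity)
    -- `β t² V³ > D L⁹`
    have hkey : D * (L : ℝ) ^ 9 < β * t ^ 2 * V L ^ 3 := by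
      have e1 : D * (L : ℝ) ^ 9 * (2 * (Real.pi ^ 2 * (c₀ * V L))) = β * (a ^ 2 * (L : ℝ) ^ 9) * V L := by
        rw [hc₀]; field_simp
      have e2 : β * (a ^ 2 * (L : ℝ) ^ 9) * V L ≤ β * V L ^ 2 * V L :=
        mul_le_mul_of_nonneg_right (mul_le_mul_of_nonneg_left hL9 hβ.le) hV0.le
      have h2 : D * (L : ℝ) ^ 9 * (2 * S) < β * V L ^ 3 := by
        calc D * (L : ℝ) ^ 9 * (2 * S) < D * (L : ℝ) ^ 9 * (2 * (Real.pi ^ 2 * (c₀ * V L))) :=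
              mul_lt_mul_of_pos_left (by linarith) (by positivity)
          _ = β * (a ^ 2 * (L : ℝ) ^ 9) * V L := e1
          _ ≤ β * V L ^ 2 * V L := e2
          _ = β * V L ^ 3 := by ring
      have h1 : β * t ^ 2 * V L ^ 3 * (2 * S) = β * V L ^ 3 := by
        rw [ht2]; field_simp
      rw [← h1] at h2
      exact lt_of_mul_lt_mul_right h2 (by positivity)
    -- cube the chain and compare
    have hc1 : (t * V L) ^ 3 ≤ (54 * (L : ℝ) ^ 3 * mag (t / β)) ^ 3 :=
      pow_le_pow_left₀ (by positivity) hchain 3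
    have hc2 : A' ^ 3 * (t / β) * (54 ^ 3 * (L : ℝ) ^ 9) < mag (t / β) ^ 3 * (54 ^ 3 * (L : ℝ) ^ 9) := by
      calc A' ^ 3 * (t / β) * (54 ^ 3 * (L : ℝ) ^ 9) = (t / β) * (D * (L : ℝ) ^ 9) := by rw [hD]; ring
        _ < (t / β) * (β * t ^ 2 * V L ^ 3) := mul_lt_mul_of_pos_left hkey (div_pos ht0 hβ)
        _ = (t * V L) ^ 3 := by field_simp
        _ ≤ (54 * (L : ℝ) ^ 3 * mag (t / β)) ^ 3 := hc1
        _ = mag (t / β) ^ 3 * (54 ^ 3 * (L : ℝ) ^ 9) := by ring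
    have hc3 : A' ^ 3 * (t / β) < mag (t / β) ^ 3 := lt_of_mul_lt_mul_right hc2 (by positivity)
    have hr : ((t / β) ^ ((1:ℝ) / 3)) ^ 3 = t / β := by
      rw [one_div]; exact Real.rpow_inv_natCast_pow (div_pos ht0 hβ).le (by norm_num)
    have hc4 : (A' * (t / β) ^ ((1:ℝ) / 3)) ^ 3 < mag (t / β) ^ 3 := by
      rw [mul_pow, hr]; exact hc3
    exact lt_of_pow_lt_pow_left₀ 3 hmag.le hc4

/-! ## Part B. The critical block of `ℤ³`: unconditional floor, super-isotherm, dichotomy, GAP -/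

/-- **The critical block variance of `ℤ³` is not `o(L^{9/2})`, unconditionally**: there is `a > 0` with
`a·L^{9/2} ≤ Σ_L = ⟨M_L²⟩_{β_c(3)}`, `M_L = Σ_{x ∈ box 3 L} σ_x`, for infinitely many `L` — the block form of
"`η ≤ 1/2` along a subsequence": at a good scale `n` of the axial rung `a ≤ n^{3/2}G_c(ne₁)`
(`criticalTwoPoint_axis_frequently_ge`, Duminil-Copin–Panis 2025 Thm 1.3) take `L = ⌊n/6⌋`; each of the
`|Λ_{L/2}| ≥ L³` rows of `Σ_L` dominates `χ(L/2)` (`card_mul_boxSum_le_blockSum`) and `χ(L/2) ≥ |Λ_{L/2}|G_c(ne₁)`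
(Messager–Miracle-Solé, `card_mul_axis_le_criticalBoxSum`, `3(L/2) ≤ n`), so `Σ_L ≥ L⁶·a n^{-3/2} ≥ (a/144)L^{9/2}`.
(Also in Literature as `criticalTwoPoint_boxPairSum_frequently_ge`.) Compare S4 `stub_blockVariance` (two-sided
`L⁵`, needs Coulomb). -/
theorem criticalBlockVariance_frequently_ge :
    ∃ a : ℝ, 0 < a ∧ ∃ᶠ L : ℕ in atTop,
      a * (L : ℝ) ^ (9 / 2 : ℝ) ≤ plusExpect 3 (criticalBeta 3) 0 (fun σ => (∑ x ∈ box 3 L, spinAt x σ) ^ 2) := by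
  obtain ⟨a, ha, h⟩ := criticalTwoPoint_axis_frequently_ge
  refine ⟨a / 144, by positivity, ?_⟩
  rw [Filter.frequently_atTop] at h ⊢
  intro M
  obtain ⟨n, hnM, hn⟩ := h (6 * (M + 1))
  refine ⟨n / 6, ?_, ?_⟩
  · have : M + 1 ≤ n / 6 := by omega
    omega
  set L : ℕ := n / 6 with hL
  have hL1 : 1 ≤ L := by omega
  have hn12 : n ≤ 12 * L := by omega
  have hLr0 : (0 : ℝ) < L := by exact_mod_cast hL1
  have hn1 : 1 ≤ n := by omega
  have hnr0 : (0 : ℝ) < n := by exact_mod_cast hn1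
  have hnpow : 0 < (n : ℝ) ^ (3 / 2 : ℝ) := Real.rpow_pos_of_pos hnr0 _
  -- the axial value at the good scale: `G_c(n e₁) ≥ a / n^{3/2}`
  have e0 : (Pi.single (⟨0, by norm_num⟩ : Fin 3) (n : ℤ) : Site 3) = Pi.single 0 (n : ℤ) := rfl
  rw [e0] at hn
  have hG : a / (n : ℝ) ^ (3 / 2 : ℝ) ≤ criticalTwoPoint 3 (Pi.single 0 (n : ℤ)) := by
    rw [div_le_iff₀ hnpow, mul_comm]; exact hn
  -- `Σ_L ≥ |Λ_{L/2}| χ(L/2) ≥ |Λ_{L/2}|² G_c(n e₁)`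
  rw [plusExpect_blockSpin_sq_eq_sum 3 L]
  have h1 := card_mul_axis_le_criticalBoxSum (m := L / 2) (s := n) (n := L / 2) (by omega) le_rfl
  have h2 := card_mul_boxSum_le_blockSum (d := 3) L
  have hcard : (L : ℝ) ^ 3 ≤ (#(box 3 (L / 2)) : ℝ) := pow_three_le_card_box_half L
  have hcard' : (L : ℝ) ^ 3 ≤ (((2 * (L / 2) + 1) ^ 3 : ℕ) : ℝ) := by
    rw [← card_box 3 (L / 2)]; exact hcard
  have hG0 : 0 ≤ criticalTwoPoint 3 (Pi.single 0 (n : ℤ)) := criticalTwoPoint_nonneg' _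
  have hmain : (L : ℝ) ^ 3 * ((L : ℝ) ^ 3 * (a / (n : ℝ) ^ (3 / 2 : ℝ))) ≤
      ∑ a ∈ box 3 L, ∑ b ∈ box 3 L, criticalCorr 3 2 ![a, b] := by
    calc (L : ℝ) ^ 3 * ((L : ℝ) ^ 3 * (a / (n : ℝ) ^ (3 / 2 : ℝ)))
        ≤ (#(box 3 (L / 2)) : ℝ) *
            ((((2 * (L / 2) + 1) ^ 3 : ℕ) : ℝ) * criticalTwoPoint 3 (Pi.single 0 (n : ℤ))) :=
          mul_le_mul hcard (mul_le_mul hcard' hG (by positivity) (Nat.cast_nonneg _))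
            (by positivity) (Nat.cast_nonneg _)
      _ ≤ (#(box 3 (L / 2)) : ℝ) * ∑ z ∈ box 3 (L / 2), criticalTwoPoint 3 z :=
          mul_le_mul_of_nonneg_left h1 (Nat.cast_nonneg _)
      _ ≤ _ := h2
  -- `n^{3/2} ≤ 144 L^{3/2}` and `L^6 = L^{9/2} L^{3/2}`
  have hn32 : (n : ℝ) ^ (3 / 2 : ℝ) ≤ 144 * (L : ℝ) ^ (3 / 2 : ℝ) := by
    have e1 : (n : ℝ) ≤ 12 * L := by exact_mod_cast hn12
    have e2 : (n : ℝ) ^ (3 / 2 : ℝ) ≤ (12 * (L : ℝ)) ^ (3 / 2 : ℝ) :=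
      Real.rpow_le_rpow (Nat.cast_nonneg n) e1 (by norm_num)
    have e3 : (12 * (L : ℝ)) ^ (3 / 2 : ℝ) = (12 : ℝ) ^ (3 / 2 : ℝ) * (L : ℝ) ^ (3 / 2 : ℝ) :=
      Real.mul_rpow (by norm_num) hLr0.le
    have e4 : (12 : ℝ) ^ (3 / 2 : ℝ) ≤ (12 : ℝ) ^ (2 : ℝ) :=
      Real.rpow_le_rpow_of_exponent_le (by norm_num) (by norm_num)
    have e5 : (12 : ℝ) ^ (2 : ℝ) = 144 := by norm_num
    have e6 : 0 ≤ (L : ℝ) ^ (3 / 2 : ℝ) := Real.rpow_nonneg hLr0.le _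
    calc (n : ℝ) ^ (3 / 2 : ℝ) ≤ (12 : ℝ) ^ (3 / 2 : ℝ) * (L : ℝ) ^ (3 / 2 : ℝ) := e2.trans e3.le
      _ ≤ 144 * (L : ℝ) ^ (3 / 2 : ℝ) := by
          have := mul_le_mul_of_nonneg_right (e4.trans e5.le) e6
          linarith
  have hsplit : (L : ℝ) ^ (9 / 2 : ℝ) * (L : ℝ) ^ (3 / 2 : ℝ) = (L : ℝ) ^ 6 := by
    rw [← Real.rpow_add hLr0]
    norm_num
  have hkey : a / 144 * (L : ℝ) ^ (9 / 2 : ℝ) ≤ (L : ℝ) ^ 3 * ((L : ℝ) ^ 3 * (a / (n : ℝ) ^ (3 / 2 : ℝ))) := by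
    rw [show (L : ℝ) ^ 3 * ((L : ℝ) ^ 3 * (a / (n : ℝ) ^ (3 / 2 : ℝ))) = (L : ℝ) ^ 6 * a / (n : ℝ) ^ (3 / 2 : ℝ)
      by ring, le_div_iff₀ hnpow]
    calc a / 144 * (L : ℝ) ^ (9 / 2 : ℝ) * (n : ℝ) ^ (3 / 2 : ℝ)
        ≤ a / 144 * (L : ℝ) ^ (9 / 2 : ℝ) * (144 * (L : ℝ) ^ (3 / 2 : ℝ)) :=
          mul_le_mul_of_nonneg_left hn32 (by positivity)
      _ = a * ((L : ℝ) ^ (9 / 2 : ℝ) * (L : ℝ) ^ (3 / 2 : ℝ)) := by ring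
      _ = (L : ℝ) ^ 6 * a := by rw [hsplit]; ring
  exact hkey.trans hmain

/-- **Super-isotherm at exponent `1/3` from a vanishing critical block Binder cumulant, unconditionally.**
If `g_L = (3Σ_L² − ⟨M_L⁴⟩)/Σ_L² → 0` (the critical block spin of `ℤ³` is asymptotically Gaussian along the
full sequence of cubes), then for every `A` and `h₀ > 0` some field `h ∈ (0, h₀]` has
`A·h^{1/3} < m(β_c(3), h)`; i.e. `limsup_{h→0⁺} m(β_c,h)·h^{-1/3} = ∞`. (T1a `sketchPub_blockTiltedMean_ge`,
S3 `stub_blockFieldDomination`, the floor `criticalBlockVariance_frequently_ge`, bookkeeping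
`superIsotherm_cuberoot_of_hypotheses`.) -/
theorem superIsotherm_cuberoot_of_vanishingBinder
    (htend : Tendsto (fun L : ℕ =>
        (3 * (plusExpect 3 (criticalBeta 3) 0 (fun σ => (∑ x ∈ box 3 L, spinAt x σ) ^ 2)) ^ 2 -
            plusExpect 3 (criticalBeta 3) 0 (fun σ => (∑ x ∈ box 3 L, spinAt x σ) ^ 4)) /
          (plusExpect 3 (criticalBeta 3) 0 (fun σ => (∑ x ∈ box 3 L, spinAt x σ) ^ 2)) ^ 2)
        atTop (𝓝 0)) (A h₀ : ℝ) (hh₀ : 0 < h₀) :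
    ∃ h : ℝ, 0 < h ∧ h ≤ h₀ ∧ A * h ^ ((1:ℝ) / 3) < magnetizationInField 3 (criticalBeta 3) h :=
  superIsotherm_cuberoot_of_hypotheses (criticalBeta_pos_holds (d := 3) (by norm_num))
    (fun L => plusExpect 3 (criticalBeta 3) 0 (fun σ => (∑ x ∈ box 3 L, spinAt x σ) ^ 2))
    (fun L => 3 * (plusExpect 3 (criticalBeta 3) 0 (fun σ => (∑ x ∈ box 3 L, spinAt x σ) ^ 2)) ^ 2 -
      plusExpect 3 (criticalBeta 3) 0 (fun σ => (∑ x ∈ box 3 L, spinAt x σ) ^ 4))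
    (magnetizationInField 3 (criticalBeta 3))
    (fun L t => plusExpect 3 (criticalBeta 3) 0 (fun σ => Real.exp (t * ∑ x ∈ box 3 L, spinAt x σ)))
    (fun L t => plusExpect 3 (criticalBeta 3) 0
      (fun σ => (∑ x ∈ box 3 L, spinAt x σ) * Real.exp (t * ∑ x ∈ box 3 L, spinAt x σ)))
    sketchPub_blockMgf_pos sketchPub_blockTiltedMean_ge
    (fun L h hh => stub_blockFieldDomination L h hh) criticalBlockVariance_frequently_ge htend A h₀ hh₀

/-- **Dichotomy / unconditional entrance, zero-field reading.** If the critical isotherm of `ℤ³` obeys the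
mean-field ceiling `m(β_c(3), h) ≤ A·h^{1/3}` for all small `h > 0` (the Aizenman–Barsky–Fernández
exponent `δ = 3` with a bounded amplitude), then the critical block Binder cumulant does NOT tend to
zero. Equivalently: at `β_c(3)`, asymptotically Gaussian block spins force
`limsup_{h→0⁺} m(β_c,h) h^{-1/3} = ∞`. -/
theorem binder_not_tendsto_zero_of_isotherm_cuberoot
    (hI : ∃ A h₀ : ℝ, 0 < h₀ ∧ ∀ h : ℝ, 0 < h → h ≤ h₀ →
        magnetizationInField 3 (criticalBeta 3) h ≤ A * h ^ ((1:ℝ) / 3)) :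
    ¬ Tendsto (fun L : ℕ =>
        (3 * (plusExpect 3 (criticalBeta 3) 0 (fun σ => (∑ x ∈ box 3 L, spinAt x σ) ^ 2)) ^ 2 -
            plusExpect 3 (criticalBeta 3) 0 (fun σ => (∑ x ∈ box 3 L, spinAt x σ) ^ 4)) /
          (plusExpect 3 (criticalBeta 3) 0 (fun σ => (∑ x ∈ box 3 L, spinAt x σ) ^ 2)) ^ 2)
        atTop (𝓝 0) := by
  intro htend
  obtain ⟨A, h₀, hh₀, hA⟩ := hI
  obtain ⟨h, hh, hhle, hlt⟩ := superIsotherm_cuberoot_of_vanishingBinder htend A h₀ hh₀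
  exact absurd (hA h hh hhle) (not_le.2 hlt)

/-- **A mean-field critical isotherm forces the near-critical Lee–Yang gap (crux 4945), unconditionally.**
If `m(β_c(3), h) ≤ A·h^{1/3}` for all small `h > 0`, then `LeeYangGap.NearCriticalLeeYangGap`
(stmt-CriticalPhenomena-4945) holds — through `binder_not_tendsto_zero_of_isotherm_cuberoot` and the landed
`stub_gapOfBinderNonvanishing` (`g_L ↛ 0 ⟹` GAP). The isotherm exponent `1/3` is the Buckingham–Gunton
partner of the printed rung `η ≤ 1/2` (`d = 3`: `(d+2−η)/(d−2+η) = 3`); no Coulomb hypothesis. -/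
theorem nearCriticalLeeYangGap_of_isotherm_cuberoot
    (hI : ∃ A h₀ : ℝ, 0 < h₀ ∧ ∀ h : ℝ, 0 < h → h ≤ h₀ →
        magnetizationInField 3 (criticalBeta 3) h ≤ A * h ^ ((1:ℝ) / 3)) :
    Summit.CriticalPhenomena.Ising3DConformalLimit.Theses.LeeYangGap.NearCriticalLeeYangGap :=
  stub_gapOfBinderNonvanishing (binder_not_tendsto_zero_of_isotherm_cuberoot hI)

end Summit.CriticalPhenomena.Ising3DConformalLimit.LeeYangGapNearCriticalLeeYangGap

end
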